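import Literature.RingTheory.Henselian.FiniteFlatHopfAlgebraTranslations
import Literature.RingTheory.Henselian.FiniteFlatHopfAlgebraUnitFactor
import Literature.RingTheory.Henselian.FiniteAlgebraProductOfLocalizations
import Literature.RingTheory.Idempotents.FiniteAlgebraLocalFactorsRank
import Literature.RingTheory.Idempotents.FiniteAlgebraLocalDecomposition
import Mathlib.RingTheory.HopfAlgebra.TensorProduct
import Mathlib.RingTheory.TensorProduct.Quotient
import Mathlib.RingTheory.TensorProduct.Free
import Mathlib.FieldTheory.IsAlgClosed.Basic
import Mathlib.LinearAlgebra.Dimension.Constructions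
import HarnessLib

/-!
# Rank of a finite flat commutative Hopf algebra over a henselian local ring = (number of geometric points) × (rank of the unit factor)
# ([Tate1997FiniteFlatGroupSchemes] (3.7); [StacksProject] Tag 04GG)

Topic `Literature/RingTheory/Henselian`; namespace `Literature.RingTheory.Henselian`.  PROOF FILE (theorems only; no definition,
no named fact, no instance, no notation, no `sorry`).  Cell `hodgecm-mathlib`, P6 «MOD programme», desk F0P6b-plan (g0) sub-line
`Cruxes/HLiu418/Lines/F0_P6b_ConnectedEtale.lean` letter (b1c)∕(b1cg) «`rank G = #G(k) · rank G⁰`», ALGEBRA HALF (strategy σ2 «degree = Σ over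
the special fibre»).  For `G = Spec B` a finite flat commutative group scheme over a henselian local ring `R` (`B` a commutative Hopf
algebra, module-finite and free over `R`), `G⁰ = Spec B₀` its unit component (`B₀ = B ⧸ (1 - e)` the corner of the separating idempotent
`e` at the unit maximal ideal `𝔫_ε = ker (B →ε R → κ(R))`, ★ `FiniteFlatHopfAlgebraUnitFactor`) and `k` an algebraically closed field under
`κ(R)`: **`rank_R B = #G(k) · rank_R B₀`** (`G(k) = (B →ₐ[R] k)`).  Over `k` every local factor of `k ⊗_R B` sits at a `k`-point and is the
translate of the unit factor (★ `FiniteFlatHopfAlgebraTranslations`); the unit factor of `k ⊗_R B` is `k ⊗_R B₀` because `B₀` has exactly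
one `k`-point.

* §1 `natCard_algHom_eq_one_of_isLocalRing` — a LOCAL module-finite algebra over an algebraically closed field has exactly one `k`-point.
* §2 (FIELD CASE) `finrank_eq_natCard_algHom_mul_finrank_unitCorner_of_isAlgClosed` — for a module-finite commutative Hopf algebra `C`
  over an algebraically closed field `k` with unit separating idempotent `e₁`: `finrank k C = #(C →ₐ[k] k) · finrank k (C ⧸ (1 - e₁))`.
* §3 (BASE CASE) `natCard_algHom_unitCorner_eq_one` (`#(B₀ →ₐ[R] k) = 1`), `isLocalRing_tensorProduct_unitCorner`, and the MAIN theorem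
  **`finrank_eq_natCard_algHom_mul_finrank_unitCorner`**: `finrank R B = #(B →ₐ[R] k) · finrank R (B ⧸ (1 - e))`.

HC_CM is proved only modulo the printed citations until rung 0 closes; this file is generic commutative algebra and changes no count.

## References
* [Tate1997FiniteFlatGroupSchemes] J. Tate, *Finite flat group schemes*, in: Cornell–Silverman–Stevens (eds.), *Modular Forms and Fermat's
  Last Theorem* (Springer 1997), (3.7) («`G = ⊔ G_i` … the `G_i ⊗ k̄` are permuted transitively by translations … `rank G = #G(k̄) · rank G⁰`»).
* [StacksProject] The Stacks Project, Tag 04GG (Algebra, Lemma 10.153.3: finite algebras over henselian local rings).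
* [MumfordAV1970] D. Mumford, *Abelian Varieties* (1970), §12 (finite group schemes over a field; translations).
* [AtiyahMacdonald1969] M. F. Atiyah, I. G. Macdonald, *Introduction to Commutative Algebra* (1969), Cor. 5.24, Cor. 7.10 (residue fields of
  maximal ideals of finitely generated algebras over a field are finite over it).
-/

set_option autoImplicit false

noncomputable section

universe u v w

open IsLocalRing TensorProduct

namespace Literature.RingTheory.Henselian

/-! ## §1 A local finite algebra over an algebraically closed field has exactly one rational point -/

section LocalPoint

variable {k : Type u} [Field k] {D : Type v} [CommRing D] [Algebra k D]

/-- The kernel of a `k`-point of a `k`-algebra is a maximal ideal. [folklore] -/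
private theorem isMaximal_ker_algHom_field {K : Type u} [Field K] {A : Type v} [CommRing A] [Algebra K A] (g : A →ₐ[K] K) :
    (RingHom.ker (g : A →+* K)).IsMaximal :=
  RingHom.ker_isMaximal_of_surjective _ fun c => ⟨algebraMap K A c, by simp⟩

/-- Two `k`-points of a commutative `k`-algebra with the same kernel are equal. [folklore] -/
private theorem algHom_eq_of_ker_eq {K : Type u} [Field K] {A : Type v} [CommRing A] [Algebra K A] (g g' : A →ₐ[K] K)
    (h : RingHom.ker (g : A →+* K) = RingHom.ker (g' : A →+* K)) : g = g' := by
  ext a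
  have ha : a - algebraMap K A (g a) ∈ RingHom.ker (g' : A →+* K) := by
    rw [← h, RingHom.mem_ker]; simp
  rw [RingHom.mem_ker, map_sub, AlgHom.coe_toRingHom, AlgHom.commutes, Algebra.algebraMap_self, RingHom.id_apply] at ha
  exact (sub_eq_zero.mp ha).symm

variable [IsLocalRing D]

/-- Any two `k`-points of a LOCAL `k`-algebra coincide (both kernels are the maximal ideal). [folklore] -/
private theorem subsingleton_algHom_of_isLocalRing : Subsingleton (D →ₐ[k] k) := by
  refine ⟨fun g g' => algHom_eq_of_ker_eq g g' ?_⟩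
  rw [IsLocalRing.eq_maximalIdeal (isMaximal_ker_algHom_field g), IsLocalRing.eq_maximalIdeal (isMaximal_ker_algHom_field g')]

variable [IsAlgClosed k] [Module.Finite k D]

/-- A local module-finite algebra over an algebraically closed field `k` has a `k`-point: its residue field is a finite, hence trivial,
extension of `k`. [cite: AtiyahMacdonald1969, Cor. 5.24 and Cor. 7.10] -/
theorem nonempty_algHom_of_isLocalRing : Nonempty (D →ₐ[k] k) := by
  haveI : Algebra.IsIntegral k (D ⧸ maximalIdeal D) := Algebra.IsIntegral.of_finite k _
  letI : Field (D ⧸ maximalIdeal D) := Ideal.Quotient.field (maximalIdeal D)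
  have hbij := IsAlgClosed.algebraMap_bijective_of_isIntegral (k := k) (K := D ⧸ maximalIdeal D)
  let ι : (D ⧸ maximalIdeal D) ≃ₐ[k] k := (AlgEquiv.ofBijective (Algebra.ofId k (D ⧸ maximalIdeal D)) hbij).symm
  exact ⟨(ι : (D ⧸ maximalIdeal D) →ₐ[k] k).comp (Ideal.Quotient.mkₐ k (maximalIdeal D))⟩

/-- **A local module-finite algebra over an algebraically closed field has EXACTLY ONE rational point**: `#(D →ₐ[k] k) = 1` (existence:
the residue field is `k`; uniqueness: every point has kernel the maximal ideal and `D = k·1 + 𝔪_D`).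
[cite: AtiyahMacdonald1969, Cor. 5.24 and Cor. 7.10] [cite: Tate1997FiniteFlatGroupSchemes, (3.7)] -/
theorem natCard_algHom_eq_one_of_isLocalRing : Nat.card (D →ₐ[k] k) = 1 := by
  haveI := subsingleton_algHom_of_isLocalRing (k := k) (D := D)
  obtain ⟨g⟩ := nonempty_algHom_of_isLocalRing (k := k) (D := D)
  haveI : Unique (D →ₐ[k] k) := uniqueOfSubsingleton g
  exact Nat.card_unique

end LocalPoint

/-! ## §2 The field case: `rank_k C = #(C →ₐ[k] k) · rank_k C⁰` for a finite commutative Hopf algebra over an algebraically closed field -/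

section FieldCase

variable {k : Type u} [Field k]

/-- Over a field the «reduction» `ker (residue ∘ g)` of a point `g` is just `ker g`. [folklore] -/
private theorem ker_residue_comp_eq_ker_of_field {A : Type v} [CommRing A] [Algebra k A] (g : A →ₐ[k] k) :
    RingHom.ker ((residue k).comp (g : A →+* k)) = RingHom.ker (g : A →+* k) := by
  ext a
  simp only [RingHom.mem_ker, RingHom.coe_comp, Function.comp_apply, IsLocalRing.residue_eq_zero_iff]
  rw [IsLocalRing.isField_iff_maximalIdeal_eq.mp (Field.toIsField k), Ideal.mem_bot]

/-- For complete orthogonal idempotents `e_𝔫` separating the maximal ideals (`e_𝔫 ≡ 1 (mod 𝔫)`, `e_𝔫 ∈ 𝔫'` for `𝔫' ≠ 𝔫`), a maximal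
ideal containing `1 - e_𝔫` IS `𝔫`. [cite: StacksProject, Tag 04GG] -/
theorem eq_of_one_sub_mem {S : Type v} [CommRing S] {e : MaximalSpectrum S → S}
    (he0 : ∀ 𝔫 𝔫', 𝔫 ≠ 𝔫' → e 𝔫 ∈ 𝔫'.asIdeal) (𝔫 : MaximalSpectrum S) {𝔪 : Ideal S} (h𝔪 : 𝔪.IsMaximal)
    (h : 1 - e 𝔫 ∈ 𝔪) : 𝔪 = 𝔫.asIdeal := by
  by_contra hne
  have hmem : e 𝔫 ∈ 𝔪 := he0 𝔫 ⟨𝔪, h𝔪⟩ (fun h' => hne (congrArg MaximalSpectrum.asIdeal h').symm)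
  have h1 : (1 : S) ∈ 𝔪 := by simpa using 𝔪.add_mem h hmem
  exact h𝔪.ne_top ((Ideal.eq_top_iff_one _).2 h1)

/-- **FIELD CASE of Tate's count.**  Let `C` be a module-finite commutative Hopf algebra over an algebraically closed field `k` and `e₁`
the separating idempotent at the unit maximal ideal `𝔫_ε = ker (C →ε k → k)` (`e₁ ≡ 1 (mod 𝔫_ε)`, `e₁ ∈ 𝔪` for every other maximal `𝔪`).
Then **`finrank k C = #(C →ₐ[k] k) · finrank k (C ⧸ (1 - e₁))`**: `C = Π_𝔫 C_𝔫` over its finitely many maximal ideals, every local factor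
`C_𝔫` has exactly one `k`-point (§1) and is carried onto the unit factor by the translation through that point (★
`finrank_corner_eq_finrank_unitCorner`). [cite: Tate1997FiniteFlatGroupSchemes, (3.7)] [cite: MumfordAV1970, §12] -/
theorem finrank_eq_natCard_algHom_mul_finrank_unitCorner_of_isAlgClosed [IsAlgClosed k] {C : Type v} [CommRing C] [HopfAlgebra k C]
    [Module.Finite k C] {e₁ : C} (he₁ : IsIdempotentElem e₁)
    (he₁1 : e₁ - 1 ∈ RingHom.ker ((residue k).comp (Bialgebra.counitAlgHom k C : C →+* k)))
    (he₁0 : ∀ 𝔪 : Ideal C, 𝔪.IsMaximal → 𝔪 ≠ RingHom.ker ((residue k).comp (Bialgebra.counitAlgHom k C : C →+* k)) → e₁ ∈ 𝔪) :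
    Module.finrank k C = Nat.card (C →ₐ[k] k) * Module.finrank k (C ⧸ Ideal.span {1 - e₁}) := by
  classical
  haveI : Fintype (MaximalSpectrum C) :=
    @Fintype.ofFinite _ (Literature.RingTheory.Idempotents.finite_maximalSpectrum (R := k) (A := C))
  obtain ⟨e, he, he1, he0⟩ := exists_completeOrthogonalIdempotents_maximalSpectrum k (S := C)
  -- each corner is local, hence has exactly one `k`-point `g 𝔫`, whose kernel is `𝔫`
  have hloc : ∀ 𝔫 : MaximalSpectrum C, IsLocalRing (C ⧸ Ideal.span {1 - e 𝔫}) := fun 𝔫 => by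
    haveI := 𝔫.isMaximal
    exact (isLocalRing_quotient_span_one_sub (e 𝔫) 𝔫.asIdeal (he1 𝔫)
      fun 𝔫' h𝔫' hne => he0 𝔫 ⟨𝔫', h𝔫'⟩ (fun h' => hne (congrArg MaximalSpectrum.asIdeal h').symm)).1
  have hpt : ∀ 𝔫 : MaximalSpectrum C, Nonempty ((C ⧸ Ideal.span {1 - e 𝔫}) →ₐ[k] k) := fun 𝔫 => by
    haveI := hloc 𝔫
    exact nonempty_algHom_of_isLocalRing
  let g₀ : ∀ 𝔫 : MaximalSpectrum C, (C ⧸ Ideal.span {1 - e 𝔫}) →ₐ[k] k := fun 𝔫 => Classical.choice (hpt 𝔫)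
  let g : MaximalSpectrum C → (C →ₐ[k] k) := fun 𝔫 => (g₀ 𝔫).comp (Ideal.Quotient.mkₐ k (Ideal.span {1 - e 𝔫}))
  have hg1 : ∀ 𝔫, g 𝔫 (e 𝔫) = 1 := fun 𝔫 => by
    change g₀ 𝔫 (Ideal.Quotient.mk (Ideal.span {1 - e 𝔫}) (e 𝔫)) = 1
    have : Ideal.Quotient.mk (Ideal.span {1 - e 𝔫}) (e 𝔫) = 1 := by
      rw [eq_comm, ← map_one (Ideal.Quotient.mk (Ideal.span {1 - e 𝔫})), Ideal.Quotient.eq]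
      exact Ideal.subset_span rfl
    rw [this, map_one]
  have hker : ∀ 𝔫, RingHom.ker ((residue k).comp (g 𝔫 : C →+* k)) = 𝔫.asIdeal := fun 𝔫 => by
    rw [ker_residue_comp_eq_ker_of_field]
    refine eq_of_one_sub_mem he0 𝔫 (isMaximal_ker_algHom_field (g 𝔫)) ?_
    rw [RingHom.mem_ker, map_sub, map_one]
    change 1 - g 𝔫 (e 𝔫) = 0
    rw [hg1, sub_self]
  -- every corner has the rank of the unit corner
  have hrank : ∀ 𝔫, Module.finrank k (C ⧸ Ideal.span {1 - e 𝔫}) = Module.finrank k (C ⧸ Ideal.span {1 - e₁}) := fun 𝔫 => by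
    refine finrank_corner_eq_finrank_unitCorner (R := k) (g 𝔫) he₁ he₁1 he₁0 (he.idem 𝔫) ?_ ?_
    · rw [hker]; exact he1 𝔫
    · intro 𝔪 h𝔪 hne
      rw [hker] at hne
      exact he0 𝔫 ⟨𝔪, h𝔪⟩ (fun h' => hne (congrArg MaximalSpectrum.asIdeal h').symm)
  -- the number of points is the number of corners
  have hone : ∀ 𝔫, Nat.card ((C ⧸ Ideal.span {1 - e 𝔫}) →ₐ[k] k) = 1 := fun 𝔫 => by
    haveI := hloc 𝔫
    exact natCard_algHom_eq_one_of_isLocalRing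
  haveI : ∀ 𝔫, Finite ((C ⧸ Ideal.span {1 - e 𝔫}) →ₐ[k] k) := fun 𝔫 =>
    (Nat.card_eq_one_iff_unique.mp (hone 𝔫)).1 |> fun _ => Nat.finite_of_card_ne_zero (by rw [hone 𝔫]; exact one_ne_zero)
  have hpts : Nat.card (C →ₐ[k] k) = Fintype.card (MaximalSpectrum C) := by
    rw [Literature.RingTheory.Idempotents.card_algHom_eq_sum (R := k) (A := C) (Ω := k)
      (fun x hx => IsIdempotentElem.iff_eq_zero_or_one.mp hx) he, Finset.sum_congr rfl fun 𝔫 _ => hone 𝔫,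
      Finset.sum_const, Finset.card_univ, smul_eq_mul, mul_one]
  rw [Literature.RingTheory.Idempotents.finrank_eq_sum_finrank_quotient (R := k) he, Finset.sum_congr rfl fun 𝔫 _ => hrank 𝔫,
    Finset.sum_const, Finset.card_univ, smul_eq_mul, hpts]

end FieldCase

/-! ## §3 The base case over a henselian local ring: `k ⊗_R B₀` is local, and `rank_R B = #(B →ₐ[R] k) · rank_R B₀` -/

section BaseCase

variable {R : Type u} [CommRing R] {B : Type v} [CommRing B]
variable (k : Type w) [Field k] [Algebra R k]

/-- If the structure map `R → k` to a field kills the maximal ideal of the local ring `R`, its kernel IS the maximal ideal. [folklore] -/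
private theorem ker_algebraMap_eq_maximalIdeal [IsLocalRing R] (hk : maximalIdeal R ≤ RingHom.ker (algebraMap R k)) :
    RingHom.ker (algebraMap R k) = maximalIdeal R :=
  ((IsLocalRing.maximalIdeal.isMaximal R).eq_of_le (RingHom.ker_ne_top _) hk).symm

section UnitCornerPoints

variable [IsLocalRing R] [HopfAlgebra R B] [Module.Finite R B]

omit [Module.Finite R B] in
/-- The `k`-point of the unit corner `B₀ = B ⧸ (1 - e)`: `B₀ →ε₀ R → k` (the counit kills `1 - e`, ★ `span_one_sub_le_ker_counit`).
[cite: Tate1997FiniteFlatGroupSchemes, (3.7) (I)] -/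
theorem exists_algHom_unitCorner_comp_mk_eq {e : B} (he : IsIdempotentElem e)
    (he1 : e - 1 ∈ RingHom.ker ((residue R).comp (Bialgebra.counitAlgHom R B : B →+* R))) :
    ∃ ψ₀ : (B ⧸ Ideal.span {1 - e}) →ₐ[R] k,
      ψ₀.comp (Ideal.Quotient.mkₐ R (Ideal.span {1 - e})) = (Algebra.ofId R k).comp (Bialgebra.counitAlgHom R B) := by
  refine ⟨Ideal.Quotient.liftₐ (Ideal.span {1 - e}) ((Algebra.ofId R k).comp (Bialgebra.counitAlgHom R B)) ?_,
    Ideal.Quotient.liftₐ_comp _ _ _⟩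
  intro b hb
  have hb' : b ∈ RingHom.ker (Bialgebra.counitAlgHom R B : B →+* R) := span_one_sub_le_ker_counit he he1 hb
  rw [RingHom.mem_ker] at hb'
  change algebraMap R k (Bialgebra.counitAlgHom R B b) = 0
  rw [show (Bialgebra.counitAlgHom R B) b = 0 from hb', map_zero]

/-- The kernel of ANY `R`-point `ψ : B₀ → k` of the unit corner over a field `k` in which `𝔪_R` dies is the maximal ideal of `B₀`
(a prime of the module-finite `R`-algebra `B₀` over `𝔪_R` is maximal; `B₀` is local, ★ `isLocalRing_unitCorner`). [cite: StacksProject, Tag 04GG] -/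
theorem ker_algHom_unitCorner_eq (hk : maximalIdeal R ≤ RingHom.ker (algebraMap R k)) {e : B}
    (he1 : e - 1 ∈ RingHom.ker ((residue R).comp (Bialgebra.counitAlgHom R B : B →+* R)))
    (he0 : ∀ 𝔪 : Ideal B, 𝔪.IsMaximal → 𝔪 ≠ RingHom.ker ((residue R).comp (Bialgebra.counitAlgHom R B : B →+* R)) → e ∈ 𝔪)
    (ψ : (B ⧸ Ideal.span {1 - e}) →ₐ[R] k) :
    RingHom.ker (ψ : (B ⧸ Ideal.span {1 - e}) →+* k) =
      (RingHom.ker ((residue R).comp (Bialgebra.counitAlgHom R B : B →+* R))).map (Ideal.Quotient.mk (Ideal.span {1 - e})) := by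
  obtain ⟨hloc, hmax⟩ := isLocalRing_unitCorner (R := R) (B := B) he1 he0
  haveI := hloc
  haveI : Algebra.IsIntegral R (B ⧸ Ideal.span {1 - e}) := Algebra.IsIntegral.of_finite R _
  haveI : (RingHom.ker (ψ : (B ⧸ Ideal.span {1 - e}) →+* k)).IsPrime := RingHom.ker_isPrime _
  have hcomap : (RingHom.ker (ψ : (B ⧸ Ideal.span {1 - e}) →+* k)).comap (algebraMap R (B ⧸ Ideal.span {1 - e})) =
      RingHom.ker (algebraMap R k) := by
    ext r
    simp only [Ideal.mem_comap, RingHom.mem_ker, AlgHom.coe_toRingHom, AlgHom.commutes]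
  have hkmax : (RingHom.ker (ψ : (B ⧸ Ideal.span {1 - e}) →+* k)).IsMaximal := by
    refine Ideal.isMaximal_of_isIntegral_of_isMaximal_comap (R := R) _ ?_
    rw [hcomap, ker_algebraMap_eq_maximalIdeal k hk]
    exact IsLocalRing.maximalIdeal.isMaximal R
  rw [IsLocalRing.eq_maximalIdeal hkmax, IsLocalRing.eq_maximalIdeal hmax]

/-- **The unit corner has EXACTLY ONE `k`-point**: `#(B₀ →ₐ[R] k) = 1` for `B₀ = B ⧸ (1 - e)` the unit corner of a module-finite commutative
Hopf algebra over a local ring `R` and `k` any field under `κ(R)` (every point has kernel `𝔪_{B₀}` and `B₀ = R·1 + 𝔪_{B₀}`, ★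
`sub_algebraMap_mem_map_unitCorner`). [cite: Tate1997FiniteFlatGroupSchemes, (3.7) (I)] -/
theorem natCard_algHom_unitCorner_eq_one (hk : maximalIdeal R ≤ RingHom.ker (algebraMap R k)) {e : B} (he : IsIdempotentElem e)
    (he1 : e - 1 ∈ RingHom.ker ((residue R).comp (Bialgebra.counitAlgHom R B : B →+* R)))
    (he0 : ∀ 𝔪 : Ideal B, 𝔪.IsMaximal → 𝔪 ≠ RingHom.ker ((residue R).comp (Bialgebra.counitAlgHom R B : B →+* R)) → e ∈ 𝔪) :
    Nat.card ((B ⧸ Ideal.span {1 - e}) →ₐ[R] k) = 1 := by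
  obtain ⟨ψ₀, -⟩ := exists_algHom_unitCorner_comp_mk_eq (R := R) (B := B) k he he1
  haveI : Subsingleton ((B ⧸ Ideal.span {1 - e}) →ₐ[R] k) := by
    refine ⟨fun ψ ψ' => ?_⟩
    ext x
    obtain ⟨r, hr⟩ := sub_algebraMap_mem_map_unitCorner (R := R) (B := B) e x
    have hψ : ∀ χ : (B ⧸ Ideal.span {1 - e}) →ₐ[R] k, χ x = algebraMap R k r := fun χ => by
      have h1 : (χ : (B ⧸ Ideal.span {1 - e}) →+* k) (x - algebraMap R _ r) = 0 := by
        rw [← RingHom.mem_ker, ker_algHom_unitCorner_eq k hk he1 he0 χ]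
        exact hr
      rw [AlgHom.coe_toRingHom, map_sub, AlgHom.commutes, sub_eq_zero] at h1
      exact h1
    rw [hψ ψ, hψ ψ']
  haveI : Unique ((B ⧸ Ideal.span {1 - e}) →ₐ[R] k) := uniqueOfSubsingleton ψ₀
  exact Nat.card_unique

/-- A maximal ideal of a module-finite commutative algebra over an algebraically closed field `K` is the kernel of a `K`-point (the residue
field is a finite extension of `K`, hence `K`). [cite: AtiyahMacdonald1969, Cor. 5.24 and Cor. 7.10] -/
theorem exists_ker_eq_of_isMaximal {K : Type w} [Field K] [IsAlgClosed K] {A : Type v} [CommRing A] [Algebra K A] [Module.Finite K A]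
    (𝔪 : Ideal A) [h𝔪 : 𝔪.IsMaximal] : ∃ χ : A →ₐ[K] K, RingHom.ker (χ : A →+* K) = 𝔪 := by
  letI : Field (A ⧸ 𝔪) := Ideal.Quotient.field 𝔪
  haveI : IsLocalRing (A ⧸ 𝔪) := inferInstance
  obtain ⟨χ₀⟩ := nonempty_algHom_of_isLocalRing (k := K) (D := A ⧸ 𝔪)
  refine ⟨χ₀.comp (Ideal.Quotient.mkₐ K 𝔪), ?_⟩
  refine (h𝔪.eq_of_le (RingHom.ker_ne_top _) fun a ha => ?_).symm
  rw [RingHom.mem_ker, AlgHom.coe_toRingHom, AlgHom.comp_apply, Ideal.Quotient.mkₐ_eq_mk, Ideal.Quotient.eq_zero_iff_mem.mpr ha,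
    map_zero]

/-- **`k ⊗_R B₀` IS LOCAL** for the unit corner `B₀` and any algebraically closed field `k` under `κ(R)`: its maximal ideals are kernels
of `k`-points (`exists_ker_eq_of_isMaximal`), and `k`-points of `k ⊗_R B₀` are `R`-points `B₀ → k` (Mathlib
`Algebra.TensorProduct.liftEquivRight`), of which there is exactly one (`natCard_algHom_unitCorner_eq_one`).
[cite: Tate1997FiniteFlatGroupSchemes, (3.7) (I)] -/
theorem isLocalRing_tensorProduct_unitCorner [IsAlgClosed k] (hk : maximalIdeal R ≤ RingHom.ker (algebraMap R k)) {e : B}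
    (he : IsIdempotentElem e) (he1 : e - 1 ∈ RingHom.ker ((residue R).comp (Bialgebra.counitAlgHom R B : B →+* R)))
    (he0 : ∀ 𝔪 : Ideal B, 𝔪.IsMaximal → 𝔪 ≠ RingHom.ker ((residue R).comp (Bialgebra.counitAlgHom R B : B →+* R)) → e ∈ 𝔪) :
    IsLocalRing (k ⊗[R] (B ⧸ Ideal.span {1 - e})) := by
  set B₀ := B ⧸ Ideal.span {1 - e}
  obtain ⟨ψ₀, -⟩ := exists_algHom_unitCorner_comp_mk_eq (R := R) (B := B) k he he1
  haveI hsub : Subsingleton (B₀ →ₐ[R] k) :=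
    (Nat.card_eq_one_iff_unique.mp (natCard_algHom_unitCorner_eq_one (R := R) (B := B) k hk he he1 he0)).1
  let Φ : k ⊗[R] B₀ →ₐ[k] k := Algebra.TensorProduct.liftEquivRight R k B₀ k ψ₀
  have hΦsurj : Function.Surjective Φ := fun c => ⟨algebraMap k _ c, by simp⟩
  haveI : Nontrivial (k ⊗[R] B₀) := Φ.toRingHom.domain_nontrivial
  refine IsLocalRing.of_unique_max_ideal ⟨RingHom.ker (Φ : k ⊗[R] B₀ →+* k), RingHom.ker_isMaximal_of_surjective _ hΦsurj,
    fun 𝔪 h𝔪 => ?_⟩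
  haveI := h𝔪
  obtain ⟨χ, hχ⟩ := exists_ker_eq_of_isMaximal (K := k) 𝔪
  have hχΦ : χ = Φ := by
    rw [← (Algebra.TensorProduct.liftEquivRight R k B₀ k).apply_symm_apply χ]
    change Algebra.TensorProduct.liftEquivRight R k B₀ k _ = Algebra.TensorProduct.liftEquivRight R k B₀ k ψ₀
    congr 1
    exact Subsingleton.elim _ _
  rw [← hχ, hχΦ]

end UnitCornerPoints

section Main

variable [HenselianLocalRing R] [HopfAlgebra R B] [Module.Finite R B] [Module.Free R B] [IsAlgClosed k]

/-- **TATE'S COUNT `rank G = #G(k) · rank G⁰` IN ALGEBRA.**  Let `B` be a commutative Hopf algebra, module-finite and free over a henselian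
local ring `R` (`G = Spec B` a finite flat commutative group scheme), `e` the separating idempotent at the unit maximal ideal
`𝔫_ε = ker (B →ε R → κ(R))` (so `G⁰ = Spec (B ⧸ (1 - e))`, ★ `FiniteFlatHopfAlgebraUnitFactor`), and `k` an algebraically closed field with
a structure map `R → k` killing `𝔪_R`.  Then **`finrank R B = #(B →ₐ[R] k) · finrank R (B ⧸ (1 - e))`**.  Proof: base change to the finite
commutative Hopf `k`-algebra `k ⊗_R B` (Mathlib), whose rank is `rank_R B`, whose `k`-points are the `R`-points `B → k`, and whose unit
factor is `k ⊗_R (B ⧸ (1 - e))` (`1 ⊗ e` is its unit separating idempotent because `k ⊗_R B₀` is local, `isLocalRing_tensorProduct_unitCorner`);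
conclude by the field case. [cite: Tate1997FiniteFlatGroupSchemes, (3.7)] [cite: MumfordAV1970, §12] -/
theorem finrank_eq_natCard_algHom_mul_finrank_unitCorner (hk : maximalIdeal R ≤ RingHom.ker (algebraMap R k)) {e : B}
    (he : IsIdempotentElem e) (he1 : e - 1 ∈ RingHom.ker ((residue R).comp (Bialgebra.counitAlgHom R B : B →+* R)))
    (he0 : ∀ 𝔪 : Ideal B, 𝔪.IsMaximal → 𝔪 ≠ RingHom.ker ((residue R).comp (Bialgebra.counitAlgHom R B : B →+* R)) → e ∈ 𝔪) :
    Module.finrank R B = Nat.card (B →ₐ[R] k) * Module.finrank R (B ⧸ Ideal.span {1 - e}) := by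
  set B₀ := B ⧸ Ideal.span {1 - e} with hB₀
  -- the base change `C = k ⊗[R] B`, a module-finite commutative Hopf `k`-algebra (Mathlib), and the idempotent `ē = 1 ⊗ e`
  set ē : k ⊗[R] B := (1 : k) ⊗ₜ[R] e with hē_def
  have hēR : ē = (Algebra.TensorProduct.includeRight : B →ₐ[R] k ⊗[R] B) e := rfl
  have hē : IsIdempotentElem ē := by rw [hēR]; exact he.map _
  have hJ : (Ideal.span {1 - e}).map (Algebra.TensorProduct.includeRight : B →ₐ[R] k ⊗[R] B) = Ideal.span {1 - ē} := by
    rw [Ideal.map_span, Set.image_singleton, map_sub, map_one, ← hēR]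
  let θ : k ⊗[R] B₀ ≃ₐ[k] (k ⊗[R] B) ⧸ Ideal.span {1 - ē} :=
    (Algebra.TensorProduct.tensorQuotientEquiv (R := R) k B k (Ideal.span {1 - e})).trans (Ideal.quotientEquivAlgOfEq k hJ)
  -- the counit of `ē` is `1`
  have hε1 : Coalgebra.counit (R := k) ē = 1 := by
    rw [hē_def, TensorProduct.counit_tmul, counit_eq_one_of_sub_one_mem he he1]
    simp
  have hεker : ∀ x : k ⊗[R] B, x ∈ RingHom.ker ((residue k).comp (Bialgebra.counitAlgHom k (k ⊗[R] B) : k ⊗[R] B →+* k)) ↔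
      Coalgebra.counit (R := k) x = 0 := fun x => by
    rw [ker_residue_comp_eq_ker_of_field, RingHom.mem_ker]
    rfl
  have hē1 : ē - 1 ∈ RingHom.ker ((residue k).comp (Bialgebra.counitAlgHom k (k ⊗[R] B) : k ⊗[R] B →+* k)) := by
    rw [hεker, map_sub, hε1, Bialgebra.counit_one, sub_self]
  -- `ē` lies in every other maximal ideal: `C ⧸ (1 - ē) ≅ k ⊗ B₀` is local
  haveI hloc : IsLocalRing ((k ⊗[R] B) ⧸ Ideal.span {1 - ē}) := by
    haveI := isLocalRing_tensorProduct_unitCorner (R := R) (B := B) k hk he he1 he0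
    exact θ.toRingEquiv.isLocalRing
  have hē0 : ∀ 𝔪 : Ideal (k ⊗[R] B), 𝔪.IsMaximal →
      𝔪 ≠ RingHom.ker ((residue k).comp (Bialgebra.counitAlgHom k (k ⊗[R] B) : k ⊗[R] B →+* k)) → ē ∈ 𝔪 := by
    intro 𝔪 h𝔪 hne
    by_contra hēm
    have h1ē : 1 - ē ∈ 𝔪 := by
      refine (h𝔪.isPrime.mem_or_mem ?_).resolve_left hēm
      rw [mul_sub, mul_one, hē.eq, sub_self]
      exact 𝔪.zero_mem
    set J : Ideal (k ⊗[R] B) := Ideal.span {1 - ē} with hJdef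
    set 𝔐 : Ideal (k ⊗[R] B) := (maximalIdeal ((k ⊗[R] B) ⧸ J)).comap (Ideal.Quotient.mk J) with h𝔐def
    have h𝔐 : 𝔐 ≠ ⊤ := by
      haveI : 𝔐.IsMaximal := Ideal.comap_isMaximal_of_surjective _ Ideal.Quotient.mk_surjective
      exact Ideal.IsMaximal.ne_top this
    have key : ∀ I : Ideal (k ⊗[R] B), I.IsMaximal → 1 - ē ∈ I → I = 𝔐 := fun I hI hI1 => by
      refine hI.eq_of_le h𝔐 ?_
      have hJI : J ≤ I := by rw [hJdef, Ideal.span_le, Set.singleton_subset_iff]; exact hI1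
      have hmapI : I.map (Ideal.Quotient.mk J) ≠ ⊤ := fun htop => hI.ne_top (by
        have h := Ideal.comap_map_of_surjective (Ideal.Quotient.mk J) Ideal.Quotient.mk_surjective I
        rw [htop, Ideal.comap_top, ← RingHom.ker_eq_comap_bot, Ideal.mk_ker, sup_eq_left.mpr hJI] at h
        exact h.symm)
      calc I ≤ (I.map (Ideal.Quotient.mk J)).comap (Ideal.Quotient.mk J) := Ideal.le_comap_map
        _ ≤ 𝔐 := Ideal.comap_mono (IsLocalRing.le_maximalIdeal hmapI)
    have hε : 1 - ē ∈ RingHom.ker ((residue k).comp (Bialgebra.counitAlgHom k (k ⊗[R] B) : k ⊗[R] B →+* k)) := by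
      rw [hεker, map_sub, hε1, Bialgebra.counit_one, sub_self]
    have hεmax := (Literature.RingTheory.Idempotents.isMaximal_ker_residue_comp (Bialgebra.counitAlgHom k (k ⊗[R] B))).1
    exact hne ((key 𝔪 h𝔪 h1ē).trans (key _ hεmax hε).symm)
  -- the field case for `k ⊗[R] B`, read back on `B`
  have hfield := finrank_eq_natCard_algHom_mul_finrank_unitCorner_of_isAlgClosed (k := k) (C := k ⊗[R] B) hē hē1 hē0
  have hpts : Nat.card (k ⊗[R] B →ₐ[k] k) = Nat.card (B →ₐ[R] k) :=
    Nat.card_congr (Algebra.TensorProduct.liftEquivRight R k B k).symm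
  haveI : Module.Free R B₀ := Literature.RingTheory.Idempotents.free_quotient_span_one_sub (R := R) he
  have hcorner : Module.finrank k ((k ⊗[R] B) ⧸ Ideal.span {1 - ē}) = Module.finrank R B₀ := by
    rw [← θ.toLinearEquiv.finrank_eq, Module.finrank_baseChange]
  rw [Module.finrank_baseChange, hpts, hcorner] at hfield
  exact hfield

end Main

end BaseCase

end Literature.RingTheory.Henselian

end
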